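import Literature.Topology.FourManifolds.SurfaceGroupNielsenCoreCasePPbAux
import HarnessLib

/-!
# Nielsen's theorem, pillar CORE: a double point at the portals of two symbols, mixed sides (αβ)

Topic `Literature/Topology/FourManifolds`.  The case of the case analysis of a double point
`a < b` on the closed path of a potential-minimal configuration (Zieschang–Vogt–Coldewey, LNM 835,
proof of Thm. 5.3.2 with Lemma 5.3.4, in the minimal-counterexample recasting) in which `a` is
interior to the kernel of an occurrence `k` (between its slots `sa - 1 | sa`, value word `V`),
`b` is interior to the kernel of an occurrence `k'` of a DIFFERENT symbol (slots `sb - 1 | sb`,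
value word `V'`), the partner `k̄` is INSIDE the subloop and the partner `k̄'` is OUTSIDE.

The crossing edges of the fixation are the formal edges at the pre-cut slots `(k, e)`, `e < sa`
(outside, facing the inside `k̄`) and at the pre-cut slots `(k', e)`, `e < sb` (inside, facing
the outside `k̄'`); the far ends are tail slots, so the edge at `(k, e)` resp. `(k', e)` has
level `e`.  The parity principle (no lone crossing edge at a level; two alone at a level share
a component) gives `sa = sb` and puts the two tail ends of level `e` on one component, so they
carry the same letter: `V[e] = V'[e]` for `e < sa`, i.e. `V[0, sa) = V'[0, sb)`.  Reading the
double point as a vertex of both occurrence paths, `E_k · V[0, sa) = E_{k'} · V'[0, sb)`, whence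
`E_k = E_{k'}`: the block of occurrences `k, …, k' - 1` has trivial value; it is non-empty,
proper and symbol-closed (`k̄` is inside, `k̄'` outside, other symbols by Claim (A)) — a
decomposition, contradicting indecomposability.

## References

* H. Zieschang, E. Vogt, H.-D. Coldewey, *Surfaces and Planar Discontinuous Groups*, LNM 835
  (1980), proof of Thm. 5.3.2 and Lemma 5.3.4. [ZieschangVogtColdewey1980]
-/

noncomputable section

namespace Literature.Topology.FourManifolds

open Literature.GroupTheory.CombinatorialGroupTheory CycFactors List

namespace SurfaceGroup

namespace Config

variable {g : ℕ} {φ : surfaceGen g → SurfaceGroup g}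

section PPio

variable (hg : 2 ≤ g) (hK : RelatorKilled φ) (hI : Indecomposable φ) (hM : MarkedNontrivial φ)
  (κ : Config φ) (hmin : κ.IsMin) (d : κ.DoublePoint)
include hg hK hI hM hmin

omit hK in
/-- **No double point at the portals of two symbols with `k̄` inside and `k̄'` outside.**
[cite: ZieschangVogtColdewey1980, proof of Thm. 5.3.2 and Lemma 5.3.4] -/
theorem false_of_doublePoint_PP_io {k k' : ℕ} (hPa : κ.PortalAt d.a k) (hPb : κ.PortalAt d.b k')
    (_hkk' : k' ≠ κ.bar k) (hk : κ.Inside d.a d.b (κ.bar k))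
    (hk' : κ.Outside d.a d.b (κ.bar k')) : False := by
  have hg1 : 1 ≤ g := by omega
  let _i : Inhabited (surfaceGen g) := ⟨(⟨0, by omega⟩, false)⟩
  have hN := κ.cycNielsen_U hg1 hI hM hmin
  have hU := κ.U_ne_nil hg1
  have hbar := κ.isPairing_bar
  have hab := d.lt
  have hbℓ := d.lt_length
  have hkw : k < κ.w.length := κ.lt_length_of_portalAt hPa (hab.trans hbℓ).le
  have hk'w : k' < κ.w.length := κ.lt_length_of_portalAt hPb hbℓ.le
  have hkU : k < κ.U.length := by rw [length_U]; exact hkw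
  have hk'U : k' < κ.U.length := by rw [length_U]; exact hk'w
  have hne : k ≠ k' := by
    rintro rfl
    exact κ.not_outside_of_inside hg1 hI hM hmin hk hk'
  have hsep := κ.ppb_sep hPa hPb hne
  have hlt : k < k' := κ.ppb_lt_of_portalAt hab hPa hPb hne
  have hP2 := DoublePoint.kpos_mem_iff_of_chainEnd κ hg1 hI hM hmin d
  -- numerical data of `k` and `k'`
  set n := (fac κ.U k).length with hn
  set n' := (fac κ.U k').length with hn'
  have hnb : (fac κ.U (κ.bar k)).length = n := hbar.length_fac_bar hkU
  have hnb' : (fac κ.U (κ.bar k')).length = n' := hbar.length_fac_bar hk'U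
  set sa := κ.slotAt k d.a with hsa
  set sb := κ.slotAt k' d.b with hsb
  obtain ⟨hsa1, hsa2⟩ := κ.slotAt_bounds_of_portalAt hg1 hI hM hmin hPa
  obtain ⟨hsb1, hsb2⟩ := κ.slotAt_bounds_of_portalAt hg1 hI hM hmin hPb
  -- the side function and (P2) in side form
  obtain ⟨s, hs_def⟩ : ∃ s : ℕ × ℕ → Bool, s = fun σ => decide (κ.SideIn d.a d.b σ) :=
    ⟨_, rfl⟩
  have hs : ∀ σ, s σ = decide (κ.SideIn d.a d.b σ) := fun σ => by rw [hs_def]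
  have hP2s : ∀ τ, IsKernelSlot κ.U τ → s τ = s (chainEnd κ.U κ.bar τ) := fun τ hτ => by
    rw [hs, hs]
    exact κ.decide_sideIn_eq_decide_sideIn_chainEnd hg1 hI hM hmin hab hsep hP2 hτ
  -- the crossing formal edges of the two portal symbols
  have hXk : ∀ q, IsCrossing s (fedge κ.U κ.bar (k, q)) ↔ q < sa := fun q => by
    rw [isCrossing_fedge, hs, hs, ← κ.fcross_iff_decide_ne]
    exact κ.fcross_iff_of_portalAt_left_of_inside hsep hPa hk q
  have hXk' : ∀ q', IsCrossing s (fedge κ.U κ.bar (k', q')) ↔ q' < sb := fun q' => by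
    rw [isCrossing_fedge, hs, hs, ← κ.fcross_iff_decide_ne]
    exact κ.fcross_iff_of_portalAt_right_of_outside hg1 hI hM hmin hab hsep hPb hk' q'
  -- their far ends are tail slots, so their levels are the slot indices
  have hTk : ∀ q, q < sa → IsTailSlot κ.U (fpartner κ.U κ.bar (k, q)) := fun q hq =>
    κ.isTailSlot_of_portalAt_left_of_inside hg1 hI hM hmin hP2 hkw hPa hk hq
  have hTk' : ∀ q', q' < sb → IsTailSlot κ.U (fpartner κ.U κ.bar (k', q')) := fun q' hq' =>
    κ.isTailSlot_of_portalAt_right_of_outside hg1 hI hM hmin hab hsep hP2 hk'w hPb hk' hq'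
  have hLk : ∀ q, q < sa → level κ.U (k, q) = q := by
    intro q hq
    have hσ : IsSlot κ.U (k, q) := ⟨hkU, by dsimp only; omega⟩
    have h1 := (hTk q hq).level_eq hN
    have h2 := hbar.level_fpartner hσ
    dsimp only [fpartner] at h1 h2
    omega
  have hLk' : ∀ q', q' < sb → level κ.U (k', q') = q' := by
    intro q' hq'
    have hσ : IsSlot κ.U (k', q') := ⟨hk'U, by dsimp only; omega⟩
    have h1 := (hTk' q' hq').level_eq hN
    have h2 := hbar.level_fpartner hσ
    dsimp only [fpartner] at h1 h2
    omega
  -- the crossing edges all of whose ends have level `e`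
  have hlev : ∀ e ε', IsEdge κ.U κ.bar ε' → IsCrossing s ε' →
      (∀ ρ' ∈ ε'.2, level κ.U ρ' = e) →
      (e < sa ∧ ε' = fedge κ.U κ.bar (k, e)) ∨ (e < sb ∧ ε' = fedge κ.U κ.bar (k', e)) := by
    intro e ε' hε' hc' hl
    rcases κ.ppb_crossing_edge_cases hg1 hI hM hmin hab hbℓ hP2 hPa hPb hsep hs hε' hc' with
      ⟨q, -, rfl⟩ | ⟨q', -, rfl⟩
    · have hq : q < sa := (hXk q).1 hc'
      have := hl (k, q) (mem_fedge.2 (Or.inl rfl))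
      rw [hLk q hq] at this
      subst this
      exact Or.inl ⟨hq, rfl⟩
    · have hq' : q' < sb := (hXk' q').1 hc'
      have := hl (k', q') (mem_fedge.2 (Or.inl rfl))
      rw [hLk' q' hq'] at this
      subst this
      exact Or.inr ⟨hq', rfl⟩
  -- PARITY, first consequence: `sa = sb` (otherwise a lone crossing edge at level `min sa sb`)
  have hsab : sa = sb := by
    by_contra hne'
    rcases Nat.lt_or_gt_of_ne hne' with h | h
    · have hσ : IsSlot κ.U (k', sa) := ⟨hk'U, by dsimp only; omega⟩
      refine false_of_crossing_alone_level hN hU hbar hP2s (isEdge_fedge hσ) ((hXk' sa).2 h)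
        ⟨(k', sa), mem_fedge.2 (Or.inl rfl), hLk' sa h⟩ fun ε' hε' hc' hl => ?_
      rcases hlev sa ε' hε' hc' hl with ⟨h1, -⟩ | ⟨-, h2⟩
      · exact absurd h1 (lt_irrefl _)
      · exact h2
    · have hσ : IsSlot κ.U (k, sb) := ⟨hkU, by dsimp only; omega⟩
      refine false_of_crossing_alone_level hN hU hbar hP2s (isEdge_fedge hσ) ((hXk sb).2 h)
        ⟨(k, sb), mem_fedge.2 (Or.inl rfl), hLk sb h⟩ fun ε' hε' hc' hl => ?_
      rcases hlev sb ε' hε' hc' hl with ⟨-, h1⟩ | ⟨h2, -⟩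
      · exact h1
      · exact absurd h2 (lt_irrefl _)
  -- PARITY, second consequence: the pre-cut parts of `V` and `V'` agree letter by letter
  have hletter : ∀ e (he : e < sa), (fac κ.U k)[e]'(by omega) = (fac κ.U k')[e]'(by omega) := by
    intro e he
    have he' : e < sb := hsab ▸ he
    have hσ : IsSlot κ.U (k, e) := ⟨hkU, by dsimp only; omega⟩
    have hσ' : IsSlot κ.U (k', e) := ⟨hk'U, by dsimp only; omega⟩
    have hpair := sameComp_of_crossing_pair_level hN hU hbar hP2s
      (ε₂ := fedge κ.U κ.bar (k', e)) (isEdge_fedge hσ) ((hXk e).2 he)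
      ⟨(k, e), mem_fedge.2 (Or.inl rfl), hLk e he⟩ (fun ε' hε' hc' hl => by
        rcases hlev e ε' hε' hc' hl with ⟨-, h⟩ | ⟨-, h⟩
        · exact Or.inl h
        · exact Or.inr h)
    have hsc : SameComp κ.U κ.bar (fpartner κ.U κ.bar (k, e)) (fpartner κ.U κ.bar (k', e)) :=
      hpair _ (mem_fedge.2 (Or.inr rfl)) _ (mem_fedge.2 (Or.inr rfl))
    have hty : slotType κ.U κ.bar (fpartner κ.U κ.bar (k', e)) =
        slotType κ.U κ.bar (fpartner κ.U κ.bar (k, e)) := by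
      rw [(hTk e he).slotType_eq, (hTk' e he').slotType_eq]
    have key := hsc.slotLetter_eq_of_slotType_eq hN hU hbar hty
    rw [hbar.slotLetter_fpartner hσ, hbar.slotLetter_fpartner hσ', hσ.slotLetter_eq,
      hσ'.slotLetter_eq] at key
    exact (ppb_letter_eq_of_inv_eq key).symm
  have htake : (fac κ.U k).take sa = (fac κ.U k').take sb := by
    rw [← hsab]
    apply List.ext_getElem
    · simp only [List.length_take]
      omega
    · intro i h1 h2
      rw [List.getElem_take, List.getElem_take]
      exact hletter i (by simp only [List.length_take] at h1; omega)
  -- the double point as a vertex of both occurrence paths: `E_k = E_{k'}`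
  have hva : κ.absv d.a = κ.occStart k * proj g (FreeGroup.mk ((fac κ.U k).take sa)) := by
    have e : kpos κ.U (k, sa) = d.a := κ.kpos_slotAt hPa.1.le
    rw [← e]
    exact κ.absv_kpos hN hkw (by omega) (by omega)
  have hvb : κ.absv d.b = κ.occStart k' * proj g (FreeGroup.mk ((fac κ.U k').take sb)) := by
    have e : kpos κ.U (k', sb) = d.b := κ.kpos_slotAt hPb.1.le
    rw [← e]
    exact κ.absv_kpos hN hk'w (by omega) (by omega)
  have hvab : κ.absv d.a = κ.absv d.b := (κ.absv_eq_absv_iff _ _).2 d.pv_eq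
  have hocc : κ.occStart k = κ.occStart k' := by
    rw [hva, hvb, htake] at hvab
    exact mul_right_cancel hvab
  -- the block `k, …, k' - 1` is non-empty, proper, symbol-closed and has trivial value
  have hbk : k < κ.bar k ∧ κ.bar k < k' := κ.ppb_btwn_of_inside hPa hPb hk
  have hnbk' := κ.ppb_not_btwn_of_outside hg1 hI hM hmin hPa hPb hk'
  refine false_of_occStart_eq hI κ hlt hk'w.le (by omega)
    (κ.blockClosed_of_bar fun j hj h1 h2 => ?_) hocc
  rcases Nat.eq_or_lt_of_le h1 with h1 | h1
  · subst h1
    exact ⟨hbk.1.le, hbk.2⟩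
  · by_cases hjb : j = κ.bar k
    · rw [hjb, κ.bar_bar hkw]
      exact ⟨le_rfl, hlt⟩
    · have hjb' : j ≠ κ.bar k' := fun h => hnbk' (by subst h; exact ⟨h1, h2⟩)
      have h3 := κ.ppb_bar_btwn hg1 hI hM hmin hP2 hPa hPb hj h1 h2 hjb hjb'
      exact ⟨h3.1.le, h3.2⟩

end PPio

end Config

end SurfaceGroup

end Literature.Topology.FourManifolds

end
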